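import Mathlib
import Summits.ValiantsHypothesis.ValiantsHypothesis.Theorems.BorderApolarityToricWitnessObstructionQPStubTorusBound

/-!
# Route RigidityForcesSymmetry — crux `RigidMinimalRepr` (stmt-ValiantsHypothesis-4163), refutation line:
# set-up of the tight case (`tightStructure_prep`)

Lead helper for `stub_tightStructure` (line `registered`, run to the negative side).  Verbatim set-up of the
tree's `stub_torusBound` (stmt-4164) for a two-sided-torus-equivariant affine determinantal representation of
`perm_m`, packaged as one existential: regularity (von zur Gathen), the generic torus element
`diag(p) ⊗ diag(q)` (`p ⊔ q = primes₂ m`) and its exact lift `(P, Q)`, the kernel weight `γ₀ ≠ 0` of `Q`, the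
`Q`-stability of `ker Λ`, the top weight `(∏ p ∏ q) γ₀` of `P` (`maxGenEigenspace_le_range_of_ne_character`),
and "every level is served on the graph of every `σ`" (`torusBound_served`).

Convention of the tree's LR17 files: `m` = size of the permanent, `n` = size of the matrix.
-/

open Matrix MvPolynomial Finset Module.End
open scoped Kronecker
open Literature.Computability.AlgebraicComplexity LRPencil

-- the mandated summit-side namespace repeats a component by design (single-problem summit)
set_option linter.dupNamespace false

namespace Summit.ValiantsHypothesis.ValiantsHypothesis.Theorems.RigidityForcesSymmetryRigidMinimalRepr

noncomputable section

/-- **Set-up of the tight case** (verbatim from the tree's `stub_torusBound`): for a two-sided-torus-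
equivariant affine determinantal representation `A` of `perm_m` (`m ≥ 3`), the generic torus element
`diag(p) ⊗ diag(q)` (`p ⊔ q = primes₂ m`) has an exact lift `(P, Q)` (`P Λ = Λ Q`, `P A_{kj} = p_k q_j A_{kj} Q`),
`ker Λ` is a `Q`-stable line of weight `γ₀ ≠ 0`, every weight of `P` other than `(∏ p ∏ q) γ₀` lives in
`range Λ`, and for every `σ ∈ 𝔖_m` and `1 ≤ s ≤ m` some weight `γ₀ ∏_{k ∈ I} p_k q_{σ k}` (`|I| = s`) of `P`
occurs. [cite: LandsbergRessayre2017, §6] -/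
theorem tightStructure_prep {m n : ℕ} (hm : 3 ≤ m)
    {A : Matrix (Fin n) (Fin n) (MvPolynomial (Fin m × Fin m) ℂ)}
    (hA : IsEquivariantDetRepr (Subgroup.closure {γ : GL (Fin m × Fin m) ℂ | ∃ d e : Fin m → ℂ,
        (γ : Matrix (Fin m × Fin m) (Fin m × Fin m) ℂ) = Matrix.diagonal (fun p => d p.1 * e p.2)})
      (perPoly (Fin m) ℂ) A) :
    ∃ (P Q : GL (Fin n) ℂ) (γ₀ : ℂ), 0 < n ∧
      (P : Matrix (Fin n) (Fin n) ℂ) * constPart A = constPart A * (Q : Matrix (Fin n) (Fin n) ℂ) ∧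
      (∀ k j, (P : Matrix (Fin n) (Fin n) ℂ) * coeffMat A (k, j) =
        ((primes₂ m (Sum.inl k) : ℂ) * primes₂ m (Sum.inr j)) •
          (coeffMat A (k, j) * (Q : Matrix (Fin n) (Fin n) ℂ))) ∧
      γ₀ ≠ 0 ∧ Module.finrank ℂ (LinearMap.ker (Matrix.toLin' (constPart A))) = 1 ∧
      LinearMap.ker (Matrix.toLin' (constPart A)) ≤
        maxGenEigenspace (Matrix.toLin' (Q : Matrix (Fin n) (Fin n) ℂ)) γ₀ ∧
      (LinearMap.ker (Matrix.toLin' (constPart A))).map (Matrix.toLin' (Q : Matrix (Fin n) (Fin n) ℂ)) =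
        LinearMap.ker (Matrix.toLin' (constPart A)) ∧
      (∀ β, β ≠ ((∏ k, (primes₂ m (Sum.inl k) : ℂ)) * ∏ j, (primes₂ m (Sum.inr j) : ℂ)) * γ₀ →
        maxGenEigenspace (Matrix.toLin' (P : Matrix (Fin n) (Fin n) ℂ)) β ≤
          LinearMap.range (Matrix.toLin' (constPart A))) ∧
      (∀ σ : Equiv.Perm (Fin m), ∀ s, 1 ≤ s → s ≤ m → ∃ I : Finset (Fin m), I.card = s ∧
        maxGenEigenspace (Matrix.toLin' (P : Matrix (Fin n) (Fin n) ℂ))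
          (γ₀ * ∏ x, (primes₂ m x : ℂ) ^ (Sum.elim (fun k => if k ∈ I then 1 else 0)
            (fun j => if j ∈ I.map σ.toEmbedding then 1 else 0) : Fin m ⊕ Fin m → ℕ) x) ≠ ⊥) := by
  classical
  -- §0 set-up, as in `stub_torusBound`: regularity, one generic torus element, its exact lift `(P, Q)`
  have haff : ∀ r c, (A r c).totalDegree ≤ 1 := hA.1.1
  have hdet : A.det = perPoly (Fin m) ℂ := hA.1.2
  have hn0 : 0 < n := pos_of_det_eq_perPoly (by omega) hdet
  have hreg : IsRegularDetRepr (perPoly (Fin m) ℂ) A :=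
    hA.isRegular_perPoly vonzurGathen1987_perm_detRepr_rank_holds hm
  have hrank : (constPart A).rank = n - 1 := hreg.2
  set Λm : Matrix (Fin n) (Fin n) ℂ := constPart A with hΛm
  set pr : Fin m ⊕ Fin m → ℕ := primes₂ m with hpr
  set d : Fin m → ℂ := fun k => (pr (Sum.inl k) : ℂ) with hd
  set e : Fin m → ℂ := fun j => (pr (Sum.inr j) : ℂ) with he
  have hd0 : ∀ i, d i ≠ 0 := fun i => primes₂_cast_ne_zero m _
  have he0 : ∀ i, e i ≠ 0 := fun i => primes₂_cast_ne_zero m _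
  have hc : ∀ x : Fin m ⊕ Fin m, ((fun x => (pr x : ℂ)) x) ≠ 0 := fun x => primes₂_cast_ne_zero m x
  let γ : GL (Fin m × Fin m) ℂ :=
    Matrix.GeneralLinearGroup.kronecker (diagUnit ℂ d hd0) (diagUnit ℂ e he0)
  have hγcoe : (γ : Matrix (Fin m × Fin m) (Fin m × Fin m) ℂ) = Matrix.diagonal d ⊗ₖ Matrix.diagonal e :=
    coe_kronecker_diagUnit d e hd0 he0
  have hγmem : γ ∈ Subgroup.closure {γ : GL (Fin m × Fin m) ℂ | ∃ d e : Fin m → ℂ,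
      (γ : Matrix (Fin m × Fin m) (Fin m × Fin m) ℂ) = Matrix.diagonal (fun p => d p.1 * e p.2)} :=
    Subgroup.subset_closure ⟨d, e, by rw [hγcoe, Matrix.diagonal_kronecker_diagonal]⟩
  obtain ⟨P, Q, hPQ, hΛ⟩ := hA.exists_lift_stabilising hγmem
  have hkj : ∀ k j, (P : Matrix (Fin n) (Fin n) ℂ) * coeffMat A (k, j) =
      (d k * e j) • (coeffMat A (k, j) * (Q : Matrix (Fin n) (Fin n) ℂ)) := by
    intro k j
    have e1 : coeffMat (Matrix.linSubstEntries γ A) (k, j) =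
        coeffMat ((P : Matrix (Fin n) (Fin n) ℂ).map C * A *
          ((Q⁻¹ : GL (Fin n) ℂ) : Matrix (Fin n) (Fin n) ℂ).map C) (k, j) := by rw [hPQ]
    rw [coeffMat_linSubstEntries _ _ haff, hγcoe, sum_kron_diagonal_diagonal_smul,
      coeffMat_C_mul_mul_C] at e1
    rw [mul_eq_of_eq_mul_mul_inv e1, Matrix.smul_mul]
  let L₀ : Lift₂ (Matrix.toLin' Λm) (fun k j => Matrix.toLin' (coeffMat A (k, j))) 1 1
      (fun x => (pr x : ℂ)) :=
    lift₂OfMatrices Λm (fun k j => coeffMat A (k, j)) 1 1 _ hc P Q hΛ (fun k j => hkj k j)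
  have hK : Module.finrank ℂ (LinearMap.ker (Matrix.toLin' Λm)) = 1 :=
    finrank_ker_toLin'_eq_one hn0 hrank
  obtain ⟨γ₀, hγ₀, hker⟩ := exists_eigenvalue_of_finrank_ker_eq_one _ L₀.C L₀.map_ker_eq hK
  have htop := maxGenEigenspace_le_range_of_ne_character hn0 hdet hrank hγcoe hPQ hker
  let ind : Finset (Fin m) → Finset (Fin m) → Fin m ⊕ Fin m → ℕ := fun I J =>
    Sum.elim (fun k => if k ∈ I then 1 else 0) (fun j => if j ∈ J then 1 else 0)
  -- §1 every level is served (verbatim from `stub_torusBound`)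
  have hserved : ∀ σ : Equiv.Perm (Fin m), ∀ s, 1 ≤ s → s ≤ m → ∃ I : Finset (Fin m), I.card = s ∧
      maxGenEigenspace (Matrix.toLin' (P : Matrix (Fin n) (Fin n) ℂ))
        (γ₀ * ∏ x, (pr x : ℂ) ^ ind I (I.map σ.toEmbedding) x) ≠ ⊥ := by
    intro σ s hs1 hsm
    let Am : Fin m → Fin m → Matrix (Fin n) (Fin n) ℂ := fun k j =>
      if j = σ k then coeffMat A (k, j) else 0
    have hkj' : ∀ k j, (P : Matrix (Fin n) (Fin n) ℂ) * Am k j =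
        ((fun x => (pr x : ℂ)) (Sum.inl k) * (fun x => (pr x : ℂ)) (Sum.inr j)) •
          (Am ((1 : Equiv.Perm (Fin m)) k) ((1 : Equiv.Perm (Fin m)) j) *
            (Q : Matrix (Fin n) (Fin n) ℂ)) := by
      intro k j
      show (P : Matrix (Fin n) (Fin n) ℂ) * Am k j = (d k * e j) • (Am k j * (Q : Matrix (Fin n) (Fin n) ℂ))
      by_cases hj : j = σ k
      · simp only [Am, if_pos hj]; exact hkj k j
      · simp only [Am, if_neg hj, Matrix.mul_zero, Matrix.zero_mul, smul_zero]
    let L : Lift₂ (Matrix.toLin' Λm) (fun k j => Matrix.toLin' (Am k j)) 1 1 (fun x => (pr x : ℂ)) :=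
      lift₂OfMatrices Λm Am 1 1 _ hc P Q hΛ hkj'
    let Dσ : TorusData₂ m (Fin n → ℂ) :=
      { Λ := Matrix.toLin' Λm, A := fun k j => Matrix.toLin' (Am k j), r := pr,
        prime := primes₂_prime m, r_inj := primes₂_injective m, L := L, γ₀ := γ₀, ker_le := hker,
        γ₀_ne := hγ₀ }
    have hAσ : ∀ k j, j ≠ σ k → Dσ.A k j = 0 := fun k j hj => by
      show Matrix.toLin' (Am k j) = 0
      simp only [Am, if_neg hj, map_zero]
    have hgen : ∃ x : Fin m → Fin m → ℂ, Function.Injective (Dσ.Λ + ∑ k, ∑ j, x k j • Dσ.A k j) := by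
      let v : Fin m × Fin m → ℂ := fun w => if w.2 = σ w.1 then 1 else 0
      refine ⟨fun k j => v (k, j), ?_⟩
      have hmat : Dσ.Λ + ∑ k, ∑ j, v (k, j) • Dσ.A k j = Matrix.toLin' (A.map (MvPolynomial.eval v)) := by
        show Matrix.toLin' Λm + ∑ k, ∑ j, v (k, j) • Matrix.toLin' (Am k j) = _
        rw [map_eval_eq A haff v, map_add, map_sum, Fintype.sum_prod_type]
        simp only [map_smul]
        congr 1
        refine Finset.sum_congr rfl fun k _ => Finset.sum_congr rfl fun j _ => ?_
        by_cases hj : j = σ k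
        · simp only [Am, if_pos hj]
        · simp only [Am, v, if_neg hj, zero_smul]
      have hdetv : (A.map (MvPolynomial.eval v)).det ≠ 0 := by
        have e2 : (A.map (MvPolynomial.eval v)).det = MvPolynomial.eval v A.det := by
          rw [RingHom.map_det]; rfl
        rw [e2, hdet, eval_perPoly]
        have hv1 : (Matrix.of fun i j : Fin m => v (i, j)) =
            (1 : Matrix (Fin m) (Fin m) ℂ).submatrix σ id := by
          ext i j
          simp only [Matrix.of_apply, Matrix.submatrix_apply, id_eq, Matrix.one_apply, v, eq_comm]
        rw [hv1, Matrix.permanent_permute_cols, Matrix.permanent_one]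
        exact one_ne_zero
      rw [hmat]
      have hunit : IsUnit (A.map (MvPolynomial.eval v)) :=
        (Matrix.isUnit_iff_isUnit_det _).2 (isUnit_iff_ne_zero.2 hdetv)
      intro x y hxy
      apply Matrix.mulVec_injective_iff_isUnit.2 hunit
      simpa [Matrix.toLin'_apply] using hxy
    have htop' : ∀ β, β ≠ Dσ.wt (fun _ => 1) → Dσ.E β ≤ LinearMap.range Dσ.Λ := by
      have hwt : Dσ.wt (fun _ => 1) = ((∏ k, d k) * ∏ j, e j) * γ₀ := by
        show γ₀ * ∏ x, (pr x : ℂ) ^ (fun _ : Fin m ⊕ Fin m => 1) x = ((∏ k, d k) * ∏ j, e j) * γ₀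
        simp only [pow_one]
        rw [Fintype.prod_sum_type, mul_comm]
      intro β hβ
      rw [hwt] at hβ
      exact htop β hβ
    have hgood : Dσ.Good (fun _ => 1) := Dσ.good_one hK hgen htop'
    obtain ⟨I, hI, hE⟩ := BorderApolarityToricWitnessObstructionQP.torusBound_served Dσ σ hAσ hgood s hs1 hsm
    exact ⟨I, hI, hE⟩
  exact ⟨P, Q, γ₀, hn0, hΛ, hkj, hγ₀, hK, hker, L₀.map_ker_eq, htop, hserved⟩

end

end Summit.ValiantsHypothesis.ValiantsHypothesis.Theorems.RigidityForcesSymmetryRigidMinimalRepr
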